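import Summits.QuantumFields.BalabanUV.T4Continuum.Support.SliceComplementFlatGap
import Summits.QuantumFields.BalabanUV.T4Continuum.Support.DivControlOfSliceClose
import Summits.QuantumFields.BalabanUV.T4Continuum.Support.VariationalVectorGarding

/-!
# T⁴ programme, spine node NE2 (U1a), lane P2 — (GF3) WITH BACKGROUND FOR COVARIANT FRAMES: THE COERCIVITY BINDER `hGdiv` OF THE VECTOR END FOR BAŁABAN's
# PROJECTED GAUGE FUNCTIONAL `projG R (ker Q_{T′})` WITH AN ARBITRARY UNITARY FRAME FIELD `T′`, `‖T′ − 1‖ ≤ τ`, AND THE TRANSPORTED LINE AVERAGE `Q_{lineT T′ R}` —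
# NO DISPLAYED ANALYTIC BINDER; then V-P and (Går) WITH BACKGROUND for covariant frames by leaf-09-g6's reductions (model level, `E = ℂ`; regular small gauge;
# numeric smallness explicit, NOT optimised)

NE2 formalisation swarm `b2b-balaban-t4-ne2-formalise-*`, leaf prover 04 GEN 6 (`prover-b2b-balaban-t4-ne2-formalise-leaf-04-g6-0`); journal INTENT
CLAIMS.log l.18848 «(GF3) WITH BACKGROUND FOR COVARIANT FRAMES — THE SLICE GAP THROUGH THE COMPLEMENT», file 3 of 3.  On top of file 1
`SliceComplementFlatGap.{sliceFlat_close_covariant, deltaGap}` (the one-sided closeness of `S_1(ker Q′_1)` to `S_R(ker Q_{T′})` for ANY unitary `T′`, through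
the complement), file 2 `DivControlOfSliceClose.divControl_of_sliceClose` ((GF3) from that ONE displayed datum, any `K`, any `Q`), leaf-03-g6's
`RegularGaugePerturbation.{QvL_sub_transport, nsqV_QvL_le_of_norm_le, nsqV_add_le, norm_piTv_sub_one_le}` (p229998), leaf-01-g5's
`VariationalVectorFederbushLine.lineT`, and leaf-09-g6 ∕ leaf-01-g5's reductions `VariationalVectorGarding.{garding_of_poincare, qWV_le_line_of_divControl}`,
`VariationalVectorPoincare.qWV_le_line_poincare` — BY NAME.

THE STATEMENTS.
 * §1 (general Hilbert `E`) `nsqV_QvL_flat_le_of_near`: `‖T − 1‖ ≤ β` (pointwise) ⟹ `nsqV (Q_1 W) ≤ 2·nsqV (Q_T W) + 2β²·qWV W`; `norm_lineT_sub_one_le`: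
   `‖lineT T′ R − 1‖ ≤ τ + n·a` for `‖T′ − 1‖ ≤ τ`, `‖T′‖ ≤ 1`, `‖R‖ ≤ 1`, `‖R − 1‖ ≤ a`; `nsqV_QvL_flat_le_line`: the two together.
 * §2 (`E = ℂ`) **`divControl_covariantFrames`** — **(GF3) WITH BACKGROUND FOR COVARIANT FRAMES**: unitary `R` with `‖R − 1‖ ≤ a`, `‖R(x,μ) − R(x−e_μ,μ)‖ ≤ ℓ`;
   ANY unitary frame field `T′` with `‖T′ − 1‖ ≤ τ` and in-block mismatch `‖R(x,μ)T′(x+e_μ)⋆T′(x) − 1‖ ≤ w`; numeric smallness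
   `(18C_f + 6)·δ₀² ≤ ½` (`δ₀ = deltaGap d n a ℓ τ w`) and `C_B·(7d(na)² + 2(τ + na)²) ≤ ½` (`C_B = (d+1)Cst(d,1)`, `C_f = d·C_B`).  THEN for every 1-form `W`:
   `n^{−d}(n²·divSq_R W) ≤ (36C_f + 8)·ScV n M R (projG R (ker Q_{T′})) W + (24C_f + 4)·nsqV (Q_{lineT T′ R} W)` — the `hGdiv` binder of
   `VariationalVectorGarding` and of `VariationalColourTaxiTowerProjG.effV_tendsto_taxiTower_projG_of_class` (p229644) for `G := projG R (ker Q_{T′})`.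
 * §3 **`hPc_covariantFrames`** (LEAF V-P WITH BACKGROUND FOR COVARIANT FRAMES, the END's `hPc k` shape `qWV ≤ C_P·(ScV W + nsqV (Q W))`) and
   **`garding_covariantFrames`** ((Går)) — adding only the classes `2d(nw)² ≤ ½`, `40d(n²p) ≤ 1` (plaquette defect `p`) those reductions consume.
NOT HERE: (ONE-min) ∕ (SLICE-min) with background; the identification of `T′` with Bałaban's taxi transports (every `T′` in the class is covered, taxi frames of a
regular `R` have `τ ≤ d·na`); gauge covariance of the three forms.

HONEST FRAMING (T4-DAG p. 1).  Rung (B)+1 only — NOT infinite volume, NOT a mass gap, NOT Clay.  NE2 NOT IN PRINT, NOT proved here.  MODEL LEVEL, `E = ℂ`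
(the flat input (1.90) is certified at `E = ℂ`): `R` is DATA presented in a regular small gauge on the WHOLE fine torus, `T′` is DATA (c5); gauge covariance NOT
proved, so this is (GF3) for data PRESENTED in a regular gauge.  The smallness thresholds are explicit and NOT optimised: they inherit the kernel reverse-Poincaré
constant `C₁ = 4d·36^d(1+nw)²` of `CovariantBlockReversePoincare` (≈ 500× the measured one, memo `t4/T4-EST-NE2-P2-REG.md` §3) through `δ₀ = 4(τC₁ + √E₁)` AND the
flat (1.90) constant `C_f = d(d+1)Cst(d,1)`: a float evaluation of the tree's constants (`Cst(2,1) ≈ 1.28·10¹²`, leaf-10-g3 NOTE CLAIMS.log l.18447; `revPC 2 n 0 = 10368`)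
gives at `d = 2` the thresholds `na, τ ≲ 7·10⁻¹³`, `n²ℓ ≲ 4·10⁻⁹`, `τ + na ≲ 3·10⁻⁷` (v1 said «≲ 10⁻⁶»: ERRATUM, v1.1) — a genuine, n-UNIFORM class, QUANTITATIVELY VOID like
the road's other kernel constants (the dominant loss is pv15's `γ₀` inside `Cst`, then `revPC`'s `36^d`).  OURS, [folklore]; nothing printed is a hypothesis; no `def`, no
`def … : Prop`, no `sorry`; axioms standard.  V-END with background ∕ NE2 NOT proved; NE3 OPEN; spine PROVED 0∕9.  HONEST DEPENDENCY (cell, verbatim):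
continuum YM on T⁴ ⇐ BetaPertH ∧ nine spine estimates (0/9 proved); BetaPertH ⇐ (D1) ∧ (D4) ∧ CAP+tail; G-an2-4 gates asym, D1 and NE2/3/4.
-/

noncomputable section

namespace Summit.QuantumFields.BalabanUV.T4Continuum.DivControlCovariantFrames

open Finset WithLp
open scoped InnerProductSpace BigOperators
open Literature.MathematicalPhysics.QuantumFieldTheory.Balaban1983to89.B5Prop11Plancherel (Tor fine unitVec Cst)
open Literature.MathematicalPhysics.QuantumFieldTheory.Balaban1983to89.B5Block118 (bpt)
open Literature.MathematicalPhysics.QuantumFieldTheory.Balaban1983to89.B5Blocks16 (blockOf)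
open Summit.QuantumFields.BalabanUV.T4Continuum.VariationalColourFederbush (norm_le_one_of_mem_unitary piTv)
open Summit.QuantumFields.BalabanUV.T4Continuum.VariationalVectorWeitzenbock (divSq)
open Summit.QuantumFields.BalabanUV.T4Continuum.VariationalVectorForm (ScV qWV qWV_nonneg)
open Summit.QuantumFields.BalabanUV.T4Continuum.VectorBlockTrialForm (nsqV nsqV_nonneg QvL roughV)
open Summit.QuantumFields.BalabanUV.T4Continuum.VariationalVectorFederbush (lineT)
open Summit.QuantumFields.BalabanUV.T4Continuum.VariationalVectorGaugeSlice (sliceSub projG projG_nonneg avgOp)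
open Summit.QuantumFields.BalabanUV.T4Continuum.VariationalVectorGaugeSliceFlat (kerAvgFlat)
open Summit.QuantumFields.BalabanUV.T4Continuum.VariationalVectorGaugeSliceB5 (flatR)
open Summit.QuantumFields.BalabanUV.T4Continuum.VariationalVectorGarding (garding_of_poincare qWV_le_line_of_divControl)
open Summit.QuantumFields.BalabanUV.T4Continuum.VariationalVectorPoincare (qWV_le_line_poincare)
open Summit.QuantumFields.BalabanUV.T4Continuum.RegularGaugePerturbation (QvL_sub_transport nsqV_QvL_le_of_norm_le nsqV_add_le norm_piTv_sub_one_le)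
open Summit.QuantumFields.BalabanUV.T4Continuum.SliceComplementFlatGap (deltaGap deltaGap_nonneg sliceFlat_close_covariant)
open Summit.QuantumFields.BalabanUV.T4Continuum.DivControlOfSliceClose (divControl_of_sliceClose)

variable {d : ℕ}
variable {E : Type*} [NormedAddCommGroup E] [InnerProductSpace ℂ E] [CompleteSpace E]
variable (n : ℕ) [NeZero n] (M : Fin d → ℕ) [hM : ∀ μ, NeZero (M μ)]

/-! ## §1 The transported line average against the flat one (general `E`) -/

section Average

/-- **`nsqV (Q_1 W) ≤ 2·nsqV (Q_T W) + 2β²·qWV W`** for any bond-indexed transports `T` with `‖T − 1‖ ≤ β` pointwise. [folklore] -/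
theorem nsqV_QvL_flat_le_of_near {T : Tor M → (Fin d → Fin n) → Fin n → Fin d → (E →L[ℂ] E)} {β : ℝ} (hβ0 : 0 ≤ β)
    (hT : ∀ y j t μ, ‖T y j t μ - 1‖ ≤ β) (W : Tor (fine n M) → Fin d → E) :
    nsqV M (QvL n M (fun _ _ _ _ => (1 : E →L[ℂ] E)) W) ≤ 2 * nsqV M (QvL n M T W) + 2 * β ^ 2 * qWV n M W := by
  have hdiff : nsqV M (QvL n M (fun _ _ _ _ => (1 : E →L[ℂ] E)) W - QvL n M T W) ≤ β ^ 2 * qWV n M W := by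
    rw [QvL_sub_transport]
    refine nsqV_QvL_le_of_norm_le n M hβ0 (fun y j t μ => ?_) W
    rw [Pi.sub_apply, Pi.sub_apply, Pi.sub_apply, Pi.sub_apply, norm_sub_rev]
    exact hT y j t μ
  calc nsqV M (QvL n M (fun _ _ _ _ => (1 : E →L[ℂ] E)) W)
      = nsqV M (QvL n M T W + (QvL n M (fun _ _ _ _ => (1 : E →L[ℂ] E)) W - QvL n M T W)) := by rw [add_sub_cancel]
    _ ≤ _ := nsqV_add_le M _ _
    _ ≤ _ := by linarith [hdiff]

omit [InnerProductSpace ℂ E] [CompleteSpace E] [NeZero n] hM in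
/-- **`‖lineT T′ R − 1‖ ≤ τ + n·a`** for `‖T′ − 1‖ ≤ τ`, `‖T′‖ ≤ 1`, `‖R‖ ≤ 1`, `‖R − 1‖ ≤ a`. [folklore] -/
theorem norm_lineT_sub_one_le [NormedSpace ℂ E] {T' : Tor (fine n M) → (E →L[ℂ] E)} {R : Tor (fine n M) → Fin d → (E →L[ℂ] E)}
    (hT'1 : ∀ x, ‖T' x‖ ≤ 1) {τ : ℝ} (hτ : ∀ x, ‖T' x - 1‖ ≤ τ) (hR1 : ∀ x μ, ‖R x μ‖ ≤ 1) {a : ℝ} (ha0 : 0 ≤ a) (ha : ∀ x μ, ‖R x μ - 1‖ ≤ a)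
    (y : Tor M) (j : Fin d → Fin n) (t : Fin n) (ν : Fin d) : ‖lineT n M T' R y j t ν - 1‖ ≤ τ + n * a := by
  unfold lineT
  have h1 : ‖piTv n M R (bpt n M y j) ν t - 1‖ ≤ n * a :=
    (norm_piTv_sub_one_le n M hR1 ha _ ν t).trans (mul_le_mul_of_nonneg_right (by exact_mod_cast t.is_lt.le) ha0)
  calc ‖T' (bpt n M y j) * piTv n M R (bpt n M y j) ν t - 1‖
      = ‖(T' (bpt n M y j) - 1) + T' (bpt n M y j) * (piTv n M R (bpt n M y j) ν t - 1)‖ := by congr 1; rw [mul_sub, mul_one]; abel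
    _ ≤ ‖T' (bpt n M y j) - 1‖ + ‖T' (bpt n M y j)‖ * ‖piTv n M R (bpt n M y j) ν t - 1‖ := (norm_add_le _ _).trans (add_le_add le_rfl (norm_mul_le _ _))
    _ ≤ τ + 1 * (n * a) := add_le_add (hτ _) (mul_le_mul (hT'1 _) h1 (norm_nonneg _) zero_le_one)
    _ = τ + n * a := by ring

/-- **`nsqV (Q_1 W) ≤ 2·nsqV (Q_{lineT T′ R} W) + 2(τ + na)²·qWV W`**. [folklore] -/
theorem nsqV_QvL_flat_le_line {T' : Tor (fine n M) → (E →L[ℂ] E)} {R : Tor (fine n M) → Fin d → (E →L[ℂ] E)}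
    (hT'1 : ∀ x, ‖T' x‖ ≤ 1) {τ : ℝ} (hτ : ∀ x, ‖T' x - 1‖ ≤ τ) (hR1 : ∀ x μ, ‖R x μ‖ ≤ 1) {a : ℝ} (ha0 : 0 ≤ a) (ha : ∀ x μ, ‖R x μ - 1‖ ≤ a)
    (W : Tor (fine n M) → Fin d → E) :
    nsqV M (QvL n M (fun _ _ _ _ => (1 : E →L[ℂ] E)) W) ≤ 2 * nsqV M (QvL n M (lineT n M T' R) W) + 2 * (τ + n * a) ^ 2 * qWV n M W := by
  have hτ0 : 0 ≤ τ := (norm_nonneg _).trans (hτ 0)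
  exact nsqV_QvL_flat_le_of_near n M (by positivity) (norm_lineT_sub_one_le n M hT'1 hτ hR1 ha0 ha) W

end Average

/-! ## §2 (GF3) with background for covariant frames (`E = ℂ`) -/

section Covariant

/-- **(GF3) WITH BACKGROUND FOR COVARIANT FRAMES — NO DISPLAYED ANALYTIC BINDER** (model level, `E = ℂ`).  Unitary `R` in a regular small gauge
(`‖R − 1‖ ≤ a`, `‖R(x,μ) − R(x−e_μ,μ)‖ ≤ ℓ`); ANY unitary frame field `T′` with `‖T′ − 1‖ ≤ τ` and in-block mismatch `‖R(x,μ)T′(x+e_μ)⋆T′(x) − 1‖ ≤ w`;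
numeric smallness `(18C_f + 6)·δ₀² ≤ ½` (`δ₀ = deltaGap d n a ℓ τ w`) and `C_B·(7d(na)² + 2(τ + na)²) ≤ ½`.  THEN for every 1-form `W`:
`n^{−d}(n²·divSq_R W) ≤ (36C_f + 8)·ScV n M R (projG R (ker Q_{T′})) W + (24C_f + 4)·nsqV (Q_{lineT T′ R} W)`, `C_f = d(d+1)Cst(d,1)`. [folklore] -/
theorem divControl_covariantFrames {T' : Tor (fine n M) → (ℂ →L[ℂ] ℂ)} (hT' : ∀ x, T' x ∈ unitary (ℂ →L[ℂ] ℂ)) {τ : ℝ} (hτ : ∀ x, ‖T' x - 1‖ ≤ τ)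
    {R : Tor (fine n M) → Fin d → (ℂ →L[ℂ] ℂ)} (hU : ∀ x μ, R x μ ∈ unitary (ℂ →L[ℂ] ℂ)) {a ℓ w : ℝ} (ha0 : 0 ≤ a)
    (ha : ∀ x μ, ‖R x μ - 1‖ ≤ a) (hℓ : ∀ x μ, ‖R x μ - R (x - unitVec (fine n M) μ) μ‖ ≤ ℓ) (hw0 : 0 ≤ w)
    (hw : ∀ (x : Tor (fine n M)) (μ : Fin d), blockOf n M (x + unitVec (fine n M) μ) = blockOf n M x →
      ‖R x μ * star (T' (x + unitVec (fine n M) μ)) * T' x - 1‖ ≤ w)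
    (hsmallδ : (18 * (d * ((d + 1 : ℝ) * Cst d 1)) + 6) * deltaGap d n a ℓ τ w ^ 2 ≤ 1 / 2)
    (hsmallQ : ((d + 1 : ℝ) * Cst d 1) * (7 * (d * ((n : ℝ) * a) ^ 2) + 2 * (τ + n * a) ^ 2) ≤ 1 / 2)
    (W : Tor (fine n M) → Fin d → ℂ) :
    ((n : ℝ) ^ d)⁻¹ * ((n : ℝ) ^ 2 * divSq (fine n M) R W)
      ≤ (36 * (d * ((d + 1 : ℝ) * Cst d 1)) + 8) * ScV n M R (projG (fine n M) R (LinearMap.ker (avgOp n M T'))) W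
        + (24 * (d * ((d + 1 : ℝ) * Cst d 1)) + 4) * nsqV M (QvL n M (lineT n M T' R) W) := by
  have hτ0 : 0 ≤ τ := (norm_nonneg _).trans (hτ 0)
  have hT'1 : ∀ x, ‖T' x‖ ≤ 1 := fun x => norm_le_one_of_mem_unitary (hT' x)
  have hR1 : ∀ x μ, ‖R x μ‖ ≤ 1 := fun x μ => norm_le_one_of_mem_unitary (hU x μ)
  have hclose := sliceFlat_close_covariant (E := ℂ) n M hT' hτ hU ha hℓ hw0 hw
  exact divControl_of_sliceClose n M ha (LinearMap.ker (avgOp n M T')) (deltaGap_nonneg (d := d) n hτ0) hclose (by positivity)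
    (nsqV_QvL_flat_le_line n M hT'1 hτ hR1 ha0 ha) hsmallδ hsmallQ W

/-! ## §3 V-P and (Går) with background for covariant frames -/

/-- **LEAF V-P WITH BACKGROUND FOR COVARIANT FRAMES** (the END's `hPc k` shape): under §2's hypotheses plus the classes `2d(nw)² ≤ ½` and `40d(n²p) ≤ 1`
(plaquette defect `≤ p`) consumed by leaf-01-g5 ∕ leaf-09-g6's reductions:  `qWV n M W ≤ C_P · (ScV n M R (projG R (ker Q_{T′})) W + nsqV (Q_{lineT T′ R} W))`,
`C_P = max(40(1 + C_D), 16 + 40(C_D′ + 16d(n²p)))`, `C_D = 36C_f + 8`, `C_D′ = 24C_f + 4`. [folklore] -/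
theorem hPc_covariantFrames {T' : Tor (fine n M) → (ℂ →L[ℂ] ℂ)} (hT' : ∀ x, T' x ∈ unitary (ℂ →L[ℂ] ℂ)) {τ : ℝ} (hτ : ∀ x, ‖T' x - 1‖ ≤ τ)
    {R : Tor (fine n M) → Fin d → (ℂ →L[ℂ] ℂ)} (hU : ∀ x μ, R x μ ∈ unitary (ℂ →L[ℂ] ℂ)) {a ℓ w p : ℝ} (ha0 : 0 ≤ a)
    (ha : ∀ x μ, ‖R x μ - 1‖ ≤ a) (hℓ : ∀ x μ, ‖R x μ - R (x - unitVec (fine n M) μ) μ‖ ≤ ℓ) (hw0 : 0 ≤ w)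
    (hw : ∀ (x : Tor (fine n M)) (μ : Fin d), blockOf n M (x + unitVec (fine n M) μ) = blockOf n M x →
      ‖R x μ * star (T' (x + unitVec (fine n M) μ)) * T' x - 1‖ ≤ w)
    (hsmallw : 2 * (d : ℝ) * ((n : ℝ) * w) ^ 2 ≤ 1 / 2) (hp : 0 ≤ p)
    (hP : ∀ x μ ν, ‖R x μ * R (x + unitVec (fine n M) μ) ν - R x ν * R (x + unitVec (fine n M) ν) μ‖ ≤ p)
    (hsmallp : 40 * (d * ((n : ℝ) ^ 2 * p)) ≤ 1)
    (hsmallδ : (18 * (d * ((d + 1 : ℝ) * Cst d 1)) + 6) * deltaGap d n a ℓ τ w ^ 2 ≤ 1 / 2)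
    (hsmallQ : ((d + 1 : ℝ) * Cst d 1) * (7 * (d * ((n : ℝ) * a) ^ 2) + 2 * (τ + n * a) ^ 2) ≤ 1 / 2)
    (W : Tor (fine n M) → Fin d → ℂ) :
    qWV n M W ≤ max (20 * (2 * (1 + (36 * (d * ((d + 1 : ℝ) * Cst d 1)) + 8))))
        (16 + 20 * (2 * ((24 * (d * ((d + 1 : ℝ) * Cst d 1)) + 4) + d * ((n : ℝ) ^ 2 * p) * 16)))
      * (ScV n M R (projG (fine n M) R (LinearMap.ker (avgOp n M T'))) W + nsqV M (QvL n M (lineT n M T' R) W)) :=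
  qWV_le_line_of_divControl n M hT' hU hw hsmallw hp hP hsmallp (projG_nonneg (fine n M) R _)
    (divControl_covariantFrames n M hT' hτ hU ha0 ha hℓ hw0 hw hsmallδ hsmallQ) W

/-- **(Går) WITH BACKGROUND FOR COVARIANT FRAMES**: `n^{−d}(n²·roughV_R W) ≤ 2(1 + C_D)·ScV W + 2(C_D′ + 16d(n²p))·nsqV (Q_{lineT T′ R} W)`. [folklore] -/
theorem garding_covariantFrames {T' : Tor (fine n M) → (ℂ →L[ℂ] ℂ)} (hT' : ∀ x, T' x ∈ unitary (ℂ →L[ℂ] ℂ)) {τ : ℝ} (hτ : ∀ x, ‖T' x - 1‖ ≤ τ)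
    {R : Tor (fine n M) → Fin d → (ℂ →L[ℂ] ℂ)} (hU : ∀ x μ, R x μ ∈ unitary (ℂ →L[ℂ] ℂ)) {a ℓ w p : ℝ} (ha0 : 0 ≤ a)
    (ha : ∀ x μ, ‖R x μ - 1‖ ≤ a) (hℓ : ∀ x μ, ‖R x μ - R (x - unitVec (fine n M) μ) μ‖ ≤ ℓ) (hw0 : 0 ≤ w)
    (hw : ∀ (x : Tor (fine n M)) (μ : Fin d), blockOf n M (x + unitVec (fine n M) μ) = blockOf n M x →
      ‖R x μ * star (T' (x + unitVec (fine n M) μ)) * T' x - 1‖ ≤ w)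
    (hsmallw : 2 * (d : ℝ) * ((n : ℝ) * w) ^ 2 ≤ 1 / 2) (hp : 0 ≤ p)
    (hP : ∀ x μ ν, ‖R x μ * R (x + unitVec (fine n M) μ) ν - R x ν * R (x + unitVec (fine n M) ν) μ‖ ≤ p)
    (hsmallp : 40 * (d * ((n : ℝ) ^ 2 * p)) ≤ 1)
    (hsmallδ : (18 * (d * ((d + 1 : ℝ) * Cst d 1)) + 6) * deltaGap d n a ℓ τ w ^ 2 ≤ 1 / 2)
    (hsmallQ : ((d + 1 : ℝ) * Cst d 1) * (7 * (d * ((n : ℝ) * a) ^ 2) + 2 * (τ + n * a) ^ 2) ≤ 1 / 2)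
    (W : Tor (fine n M) → Fin d → ℂ) :
    ((n : ℝ) ^ d)⁻¹ * ((n : ℝ) ^ 2 * roughV n M R W)
      ≤ 2 * (1 + (36 * (d * ((d + 1 : ℝ) * Cst d 1)) + 8)) * ScV n M R (projG (fine n M) R (LinearMap.ker (avgOp n M T'))) W
        + 2 * ((24 * (d * ((d + 1 : ℝ) * Cst d 1)) + 4) + d * ((n : ℝ) ^ 2 * p) * 16) * nsqV M (QvL n M (lineT n M T' R) W) := by
  have hR1 : ∀ x μ, ‖R x μ‖ ≤ 1 := fun x μ => norm_le_one_of_mem_unitary (hU x μ)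
  have hPoinc := qWV_le_line_poincare n M hT' hR1 hw hsmallw
  have hsmall : 2 * (20 : ℝ) * (d * ((n : ℝ) ^ 2 * p)) ≤ 1 := by linarith
  exact garding_of_poincare n M hU hp hP (projG_nonneg (fine n M) R _)
    (divControl_covariantFrames n M hT' hτ hU ha0 ha hℓ hw0 hw hsmallδ hsmallQ) hPoinc hsmall W

end Covariant

end Summit.QuantumFields.BalabanUV.T4Continuum.DivControlCovariantFrames

end
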